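import Mathlib.RingTheory.Smooth.Locus
import HarnessLib

/-!
# Smoothness at a prime: transport along isomorphisms and localizations

Topic: `Literature/AlgebraicGeometry/Smoothening`; two bookkeeping lemmas for Mathlib's
`Algebra.IsSmoothAt R p` (`A_p` formally smooth over `R`), used in the proof of
Bosch–Lütkebohmert–Raynaud, *Néron Models*, Lemma 3.3/1 ⟹ to move smoothness between a
finitely presented algebra, its localizations and isomorphic models:

* `isSmoothAt_iff_of_isLocalization_away` — for `A → A[1/f]` and a prime `p` of `A[1/f]`,
  `A[1/f]` is smooth at `p` iff `A` is smooth at `p ∩ A` (pointwise form of Mathlib's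
  `Algebra.smoothLocus_comap_of_isLocalization`);
* `isSmoothAt_comap_algEquiv_iff` — smoothness at a prime is invariant under `R`-algebra
  isomorphisms (the localizations at corresponding primes are isomorphic over `R`, Mathlib
  `IsLocalization.algEquivOfAlgEquiv`).

Folklore; no named facts are introduced (D-0026).
-/

noncomputable section

namespace Literature.AlgebraicGeometry.Smoothening

universe u

open Algebra

section Away

variable (R : Type u) [CommRing R] (A : Type u) [CommRing A] [Algebra R A]
  (Af : Type u) [CommRing Af] [Algebra A Af] [Algebra R Af] [IsScalarTower R A Af]

/-- **Smoothness at a prime along `A → A[1/f]`**: `A[1/f]` is smooth over `R` at `p` iff `A` is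
smooth over `R` at `p ∩ A` (the local rings coincide). [folklore] -/
theorem isSmoothAt_iff_of_isLocalization_away (f : A) [IsLocalization.Away f Af] (p : Ideal Af)
    [p.IsPrime] :
    Algebra.IsSmoothAt R p ↔ Algebra.IsSmoothAt R (p.comap (algebraMap A Af)) := by
  have h := Set.ext_iff.mp (Algebra.smoothLocus_comap_of_isLocalization (R := R) (A := A) f)
    ⟨p, inferInstance⟩
  -- `h : ⟨p⟩ ∈ comap ⁻¹' smoothLocus R A ↔ ⟨p⟩ ∈ smoothLocus R Af`
  exact h.symm

end Away

section AlgEquiv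

variable (R : Type u) [CommRing R] {A : Type u} [CommRing A] [Algebra R A]
  {B : Type u} [CommRing B] [Algebra R B] (e : A ≃ₐ[R] B)

/-- Under an isomorphism `e : A ≅ B`, the complement of `e⁻¹(p)` maps onto the complement of
`p`. [folklore] -/
theorem map_primeCompl_comap_algEquiv (p : Ideal B) [p.IsPrime] :
    (p.comap e.toRingEquiv.toRingHom).primeCompl.map e = p.primeCompl := by
  ext x
  constructor
  · rintro ⟨y, hy, rfl⟩
    exact hy
  · intro hx
    refine ⟨e.symm x, ?_, e.apply_symm_apply x⟩
    change e.symm x ∉ Ideal.comap e.toRingEquiv.toRingHom p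
    rw [Ideal.mem_comap]
    change ¬ e (e.symm x) ∈ p
    rw [e.apply_symm_apply]
    exact hx

/-- **Smoothness at a prime is invariant under `R`-algebra isomorphisms**: `A` is smooth at
`e⁻¹(p)` iff `B` is smooth at `p`, for `e : A ≅ B` (the localizations at corresponding primes
are isomorphic over `R`, Mathlib `IsLocalization.algEquivOfAlgEquiv`). [folklore] -/
theorem isSmoothAt_comap_algEquiv_iff (p : Ideal B) [p.IsPrime] :
    Algebra.IsSmoothAt R (p.comap e.toRingEquiv.toRingHom) ↔ Algebra.IsSmoothAt R p :=
  Algebra.FormallySmooth.iff_of_equiv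
    (IsLocalization.algEquivOfAlgEquiv (Localization.AtPrime (p.comap e.toRingEquiv.toRingHom))
      (Localization.AtPrime p) e (map_primeCompl_comap_algEquiv R e p))

end AlgEquiv

end Literature.AlgebraicGeometry.Smoothening

end
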